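import Summits.BirchSwinnertonDyer.BirchSwinnertonDyer.Theorems.GenusKolyvaginAtTwoShaCardDvdPowAtTwoRTSharpExponentRat
import Summits.BirchSwinnertonDyer.BirchSwinnertonDyer.Theorems.GenusKolyvaginAtTwoShaCardDvdPowAtTwoRTShaFiniteAtTwoCTQ
import Summits.BirchSwinnertonDyer.BirchSwinnertonDyer.Theorems.GenusKolyvaginAtTwoShaCardDvdPowAtTwoRTRankQ
import HarnessLib

/-!
# Route `GenusKolyvaginAtTwo`, crux U_T `ShaCardDvdPowAtTwoRT` (stmt-BirchSwinnertonDyer-23658), LINE 19 `rational_pair_descent` v1.1 —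
# STUB PAIRCOUNT `stub_shaRatCardDvdOfMinimalTwin` BY NAME: `#Ш(E/ℚ)[2^∞] ∣ 2^(2M₀)` on U_T's frame with `w(E) = 1` and a 2-Selmer-minimal
# twin `Wd ≅ E^(d_K)` with `ord₂ c(Wd) ≤ 1` (general odd `d_K`) — UNCONDITIONAL modulo the crux's antecedent Q2

Seat `bsd-line-gk2-p4` g22 (WIDTH-5 attach, cell `bsd-f1-sign2`), `--supports stmt-BirchSwinnertonDyer-23658` (registered stub of LINE 19).
THEOREMS ONLY (no definition, no named fact, no `sorry`).  BSD is NOT proved by any of this; U_T is NOT proved (SANDWICH′ and the declared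
RESIDUAL remain); nothing is closed.

COMPOSITION (LEAD gk2-p1 g19's v1.1 road, `Lines/rational_pair_descent.lean`): (B2Q) this seat's `two_pow_M0_smul_eq_zero_of_mem_sha_rat_onHabitat`
(p748779: `2^{M₀} · Ш(E/ℚ)[2^∞] = 0`, Kolyvagin's B₂ at 2 over ℚ, sharp) + (RANKQ) gk2-p3 g26's
`natCard_sha_torsionBy_two_dvd_four_of_genusBudget_le_one_unramified` (p749000: `#Ш(E/ℚ)[2] ∣ 4`, Mazur–Rubin Cor. 3.4(i) for the Heegner twin at
general odd `d_K`, `2` split or inert) + (CTQ) gk2-p5 g29's `natCard_primaryComponent_sha_rat_two_dvd_of_exponent_of_card_sha_two_torsion_le_onHabitat`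
(p748034: `2^e` kills and `#Ш[2] ≤ 4` ⟹ `#Ш[2^∞] ∣ 4^e`).  The antecedents Q5R and the Q1-shape clause, `¬ IsOfFinAddOrder P(1)` and the lower
divisibility `2^{M₀} ∣ P(1)` are not used.

References: [Kolyvagin1989Izv] Thm. B₂, §3; [McCallumLMS1991] §1 Theorem; [MazurRubin2010] Cor. 3.4 (i); [Kramer1981] Thm. 1; [MilneADT2006] I §6.
-/

set_option autoImplicit false
-- the Theorems namespace of this sub repeats the summit name by design (D-0017 nested layout)
set_option linter.dupNamespace false

noncomputable section

open scoped Classical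
open scoped AddSubgroup

namespace Summit.BirchSwinnertonDyer.BirchSwinnertonDyer.Theorems.GenusExact.RationalPairDescent

open WeierstrassCurve NumberField IsDedekindDomain Field Literature.NumberTheory.EllipticCurves
  Literature.NumberTheory.GaloisRepresentations Literature.NumberTheory.EllipticCurves.ModularForms
open Literature.NumberTheory
open Summit.BirchSwinnertonDyer.BirchSwinnertonDyer.Theses.GenusKolyvaginAtTwo
open Summit.BirchSwinnertonDyer.BirchSwinnertonDyer.Theorems.GenusExact.PlusDescent

/-- **Stub PAIRCOUNT of LINE 19 v1.1, BY NAME and UNCONDITIONAL (modulo the crux's antecedent Q2)**: on U_T's frame with `w(E) = 1` and a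
2-Selmer-minimal globally minimal twin model `Wd ≅ E^(d_K)` with `ord₂ c(Wd) ≤ 1`: **`#Ш(E/ℚ)[2^∞] ∣ 2^(2M₀)`** — Kolyvagin over `ℚ` at `2`
for the rank-zero member = (B2Q) + (RANKQ) + (CTQ), see the module docstring. [cite: Kolyvagin1989Izv, Thm. B₂, §3]
[cite: McCallumLMS1991, §1 Theorem] [cite: MazurRubin2010, Cor. 3.4 (i)] -/
theorem stub_shaRatCardDvdOfMinimalTwin :
    KolyvaginRelationAtTwo → EquivariantChebotarevAtTwoR → (∀ (W : WeierstrassCurve ℚ) [W.IsElliptic], W.Δ < 0 → ∀ (c₀ : Field.absoluteGaloisGroup ℚ), Literature.NumberTheory.GaloisRepresentations.IsComplexConjugation (Rat.castHom ℝ) c₀ → ∀ (M : ℕ), ∃ P : W.geomTorsion ((2 ^ M : ℕ) : ℤ), ∀ Q : W.geomTorsion ((2 ^ M : ℕ) : ℤ), ∃ a b : ℤ, Q = a • P + b • (c₀ • P)) → ∀ (W : WeierstrassCurve ℚ) [W.IsElliptic] [W.IsGloballyMinimal] [NeZero (W.conductorNorm ℤ)], ¬ W.HasCM → Odd W.tamagawaProduct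 → ∀ (v : IsDedekindDomain.HeightOneSpectrum (NumberField.RingOfIntegers ℚ)), ((2 : ℕ) : NumberField.RingOfIntegers ℚ) ∉ v.asIdeal → ((W.conductorNorm ℤ : ℕ) : NumberField.RingOfIntegers ℚ) ∈ v.asIdeal → W.HasMultiplicativeReductionAt v → W.Δ < 0 → ∀ (K : Type) [Field K] [NumberField K], Literature.NumberTheory.EllipticCurves.IsImaginaryQuadratic K → Odd (NumberField.discr K) → NumberField.discr K ≠ -3 → Literature.NumberTheory.EllipticCurves.SatisfiesHeegnerHypothesis (W.conductorNorm ℤ) K → ¬ IsSquare ((NumberField.discr K : ℚ) * -|W.Δ|) → ¬ IsSquare ((NumberField.discr K : ℚ) * (-(2 * |W.Δ|))) → (∀ n : ℕ, 0 < n → W.HasSurjectiveModNGaloisRep ((2 : ℤ) ^ n)) → ∀ (Dt : Literature.NumberTheory.EllipticCurves.ModularForms.ModularParametrizationData W (W.conductorNorm ℤ)) (β : ℤ) (ι : K →+* ℂ) (d₁ : Literature.NumberTheory.EllipticCurves.KolyvaginHeegnerData Dt β ι 1), ¬ IsOfFinAddOrder d₁.derivedPoint → ∀ (M₀ : ℕ),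 (∃ Q : (W.baseChange (Literature.NumberTheory.EllipticCurves.ringClassField K ι 1)).toAffine.Point, ((2 ^ M₀ : ℕ) : ℤ) • Q = d₁.derivedPoint) → (¬ ∃ Q : (W.baseChange (Literature.NumberTheory.EllipticCurves.ringClassField K ι 1)).toAffine.Point, ((2 ^ (M₀ + 1) : ℕ) : ℤ) • Q = d₁.derivedPoint) →
      W.rootNumber = 1 → ∀ (Wd : WeierstrassCurve ℚ) [Wd.IsElliptic] [Wd.IsGloballyMinimal],
        (∃ C : WeierstrassCurve.VariableChange ℚ, C • W.quadraticTwist (NumberField.discr K : ℚ) = Wd) →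
        Nat.card (Wd.selmerGroup 2) = 2 → padicValNat 2 Wd.tamagawaProduct ≤ 1 →
        Nat.card (AddCommGroup.primaryComponent W.sha 2) ∣ 2 ^ (2 * M₀) := by
  intro hQ2 _hQ5R _hQ1 W _ _ _ hcm hT v h2v hNv hmult hneg K _ _ hIQ hodd h3 hHe hsq1 hsq2 hρ Dt β ι d₁ _hy M₀ _hdiv hndiv hw1 Wd _ _ hWd hSel hle
  haveI : Fact (Nat.Prime 2) := ⟨Nat.prime_two⟩
  -- (B2Q): `2^{M₀}` kills `Ш(E/ℚ)[2^∞]` (this seat, p748779)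
  have hexp : ∀ x ∈ AddCommGroup.primaryComponent W.sha 2, 2 ^ M₀ • x = 0 := by
    intro x hx
    obtain ⟨k, hk⟩ := (AddCommGroup.mem_primaryComponent).mp hx
    have hk' : ((2 ^ k : ℕ) : ℤ) • (x : W.galH1) = 0 := by
      rw [natCast_zsmul, ← AddSubgroupClass.coe_nsmul, hk, ZeroMemClass.coe_zero]
    have h := two_pow_M0_smul_eq_zero_of_mem_sha_rat_onHabitat hQ2 W hcm hT v h2v hNv hmult hneg K hIQ hodd h3 hHe hsq1 hsq2 hρ Dt β ι d₁
      M₀ hndiv hw1 k (x : W.galH1) x.2 hk'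
    rw [natCast_zsmul, ← AddSubgroupClass.coe_nsmul] at h
    exact_mod_cast h
  -- (RANKQ): `#Ш(E/ℚ)[2] ∣ 4` (gk2-p3 g26, p749000)
  have hrk : Nat.card (AddSubgroup.torsionBy W.sha ((2 : ℕ) : ℤ)) ≤ 4 := by
    have h4 := natCard_sha_torsionBy_two_dvd_four_of_genusBudget_le_one_unramified W hneg hT hIQ hodd hHe Wd hWd hle hSel
    have h4' : Nat.card (AddSubgroup.torsionBy W.sha ((2 : ℕ) : ℤ)) ∣ 4 := by simpa using h4
    exact Nat.le_of_dvd (by norm_num) h4'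
  -- (CTQ): the count (gk2-p5 g29, p748034)
  exact natCard_primaryComponent_sha_rat_two_dvd_of_exponent_of_card_sha_two_torsion_le_onHabitat hQ2 W hcm hT v h2v hNv hmult hneg K hIQ
    hodd h3 hHe hsq1 hsq2 hρ Dt β ι d₁ M₀ hndiv hexp hrk

end Summit.BirchSwinnertonDyer.BirchSwinnertonDyer.Theorems.GenusExact.RationalPairDescent

end
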